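import Literature.IUT.LogThetaLattice.GlobalRealifiedLGPFrobenioids

/-!
# [IUTchI] Example 3.5 (i), (ii), (iii): "`Prime(Φ_{𝒞⊩_mod}) ⥲ V_mod`" — kernel witness at the divisor-monoid level
# (proof-only)

S. Mochizuki, *Inter-universal Teichmüller theory I*, kurims manuscript (May 2020), §3, Example 3.5 (i) p. 84:
"the divisor monoid `Φ_{𝒞⊩_mod}` of `𝒞⊩_mod` may be thought of as a single abstract monoid, whose set of primes,
which we denote `Prime(𝒞⊩_mod)`, is in natural bijective correspondence with `V_mod`"; (ii) p. 85 `𝒞⊩_tht` "an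
isomorphic copy"; (iii) p. 86 the `𝒟`-version `Prime(𝒟⊩_mod) ⥲ V̲` [claim: Mochizuki2012, status: disputed].
abc-iut-L5-t2 typed `Φ_{𝒞⊩_mod}` REAL as the free `ℝ≥0`-module `InitialThetaData.PhiMod = (V_mod →₀ ℝ≥0)` with the
distinguished elements `logMod v = log⊢_mod(p_v)` (`GlobalRealifiedFrobenioids.lean`, p405521, FROZEN); the
"primes ↔ V_mod" clause had no kernel statement there. PROOF-ONLY companion (abc-iut cell, seat abc-iut-w4-d013;
no definitions): with primes in the sense of [FrdI] §0 (the tree's `Literature.AlgebraicGeometry.Frobenioids.Primes`,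
`≼`-classes of primary elements) and the generic lemma `Literature.IUT.LogThetaLattice.FinsuppNNReal.primesEquiv`
(p412468), the EXPLICIT map `v ↦ [log⊢_mod(p_v)]` is a well-defined bijection `V_mod → Prime(Φ_{𝒞⊩_mod})` — the shape of
abc-iut-L1-t3's `Ex63_primes` for [FrdI] Ex. 6.3 — and likewise for `Φ_{𝒞⊩_tht}` and `Φ_{𝒟⊩_mod}` (same coordinates),
and through `V̲ ⥲ V_mod` ([IUTchI] Def. 3.1 (e), `InitialThetaData.V_bijOn`) the printed `Prime(𝒟⊩_mod) ⥲ V̲`.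
Import direction: this [IUTchI]-side witness imports the [IUTchIII]-side file that carries the generic lemma (no
cycle: that file's imports are [IUTchI] Ex. 3.5 / [IUTchII] Cor. 4.5 data only). Nothing here asserts a disputed
claim or takes a side on [IUTchIII] Cor. 3.12; typed ≠ proved.
-/

noncomputable section

namespace Literature.IUT.HodgeTheaters

namespace InitialThetaData

open Literature.AlgebraicGeometry.Frobenioids Literature.IUT.LogThetaLattice
open scoped NNReal Literature.AlgebraicGeometry.Frobenioids

universe u v w

variable {F : Type u} {K : Type v} {Fbar : Type w} [Field F] [NumberField F] [Field K]
  [NumberField K] [Algebra F K] [Field Fbar] [Algebra F Fbar] [Algebra K Fbar]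
  {E : WeierstrassCurve F} [E.IsElliptic] {l : ℕ} {P : BadPlacePredicates K}
  (D : InitialThetaData F K Fbar E l P)

/-- **IUTchI:Ex3.5(i)** (kurims p. 84) `log⊢_mod(p_v)` is a PRIMARY element of the divisor monoid `Φ_{𝒞⊩_mod}`
([FrdI] §0): it spans the prime of `v`. [claim: Mochizuki2012, status: disputed] -/
theorem isPrimary_logMod (v : Val (fieldOfModuli E)) : Literature.AlgebraicGeometry.Frobenioids.IsPrimary (Multiplicative.ofAdd (D.logMod v)) :=
  FinsuppNNReal.isPrimary_single v

/-- **IUTchI:Ex3.5(i)** (kurims p. 84) **"`Prime(𝒞⊩_mod)` is in natural bijective correspondence with `V_mod`"** —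
kernel witness at the divisor-monoid level: `v ↦ [log⊢_mod(p_v)]` is a bijection `V_mod → Prime(Φ_{𝒞⊩_mod})`
(its inverse is `FinsuppNNReal.primesEquiv`). [claim: Mochizuki2012, status: disputed] -/
theorem primes_phiMod_bijective :
    Function.Bijective fun v : Val (fieldOfModuli E) =>
      (Quotient.mk (Literature.AlgebraicGeometry.Frobenioids.primarySetoid _) ⟨Multiplicative.ofAdd (D.logMod v), D.isPrimary_logMod v⟩ :
        Literature.AlgebraicGeometry.Frobenioids.Primes (Multiplicative D.PhiMod)) :=
  (FinsuppNNReal.primesEquiv (ι := Val (fieldOfModuli E))).symm.bijective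

/-- **IUTchI:Ex3.5(i)** (kurims p. 84) The prime-to-place map inverts `v ↦ [log⊢_mod(p_v)]`: `primesEquiv` sends the
class of `log⊢_mod(p_v)` to `v`. [claim: Mochizuki2012, status: disputed] -/
theorem primesEquiv_mk_logMod (v : Val (fieldOfModuli E)) :
    FinsuppNNReal.primesEquiv (Quotient.mk (Literature.AlgebraicGeometry.Frobenioids.primarySetoid _)
      ⟨Multiplicative.ofAdd (D.logMod v), D.isPrimary_logMod v⟩ : Literature.AlgebraicGeometry.Frobenioids.Primes (Multiplicative D.PhiMod)) = v :=
  FinsuppNNReal.primesEquiv_mk_single v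

/-- **IUTchI:Ex3.5(ii)** (kurims p. 85) `Prime(Φ_{𝒞⊩_tht}) ⥲ V_mod` for the isomorphic copy `Φ_{𝒞⊩_tht} = Φ_{𝒞⊩_mod}·log(Θ)`
(same coordinates; the class of `log⊢_mod(p_v)·log(Θ)` ↦ `v`). [claim: Mochizuki2012, status: disputed] -/
theorem primes_phiTht_bijective :
    Function.Bijective fun v : Val (fieldOfModuli E) =>
      (Quotient.mk (Literature.AlgebraicGeometry.Frobenioids.primarySetoid _)
        ⟨Multiplicative.ofAdd (D.modToTht (D.logMod v)), D.isPrimary_logMod v⟩ :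
        Literature.AlgebraicGeometry.Frobenioids.Primes (Multiplicative D.PhiTht)) :=
  (FinsuppNNReal.primesEquiv (ι := Val (fieldOfModuli E))).symm.bijective

/-- **IUTchI:Ex3.5(iii)** (kurims p. 86) `Prime(Φ_{𝒟⊩_mod}) ⥲ V_mod` for the `𝒟`-version `Φ_{𝒟⊩_mod}` (another copy of
`Φ_{𝒞⊩_mod}`, `InitialThetaData.PhiDMod`; the class of `log^𝒟_mod(p_v)` ↦ `v`). [claim: Mochizuki2012, status: disputed] -/
theorem primes_phiDMod_bijective :
    Function.Bijective fun v : Val (fieldOfModuli E) =>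
      (Quotient.mk (Literature.AlgebraicGeometry.Frobenioids.primarySetoid _)
        ⟨Multiplicative.ofAdd (D.modToDMod (D.logMod v)), D.isPrimary_logMod v⟩ :
        Literature.AlgebraicGeometry.Frobenioids.Primes (Multiplicative D.PhiDMod)) :=
  (FinsuppNNReal.primesEquiv (ι := Val (fieldOfModuli E))).symm.bijective

/-- **IUTchI:Ex3.5(iii)** (kurims p. 86) **"`Prime(𝒟⊩_mod) ⥲ V̲`" VERBATIM**: through the bijection `V̲ ⥲ V_mod` of
[IUTchI] Def. 3.1 (e) (`InitialThetaData.V_bijOn`), `v̲ ↦ [log^𝒟_mod(p_v)]` (`v` the image of `v̲` in `V_mod`) is a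
bijection from `V̲ ⊆ V(K)` onto `Prime(Φ_{𝒟⊩_mod})`. [claim: Mochizuki2012, status: disputed] -/
theorem primes_phiDMod_bijective_underline :
    Function.Bijective fun w : D.V =>
      (Quotient.mk (Literature.AlgebraicGeometry.Frobenioids.primarySetoid _)
        ⟨Multiplicative.ofAdd (D.modToDMod (D.logMod (toVMod F K E (w : Val K)))),
          D.isPrimary_logMod (toVMod F K E (w : Val K))⟩ : Literature.AlgebraicGeometry.Frobenioids.Primes (Multiplicative D.PhiDMod)) :=
  D.primes_phiDMod_bijective.comp
    ((Equiv.Set.univ (Val (fieldOfModuli E))).bijective.comp (D.V_bijOn.equiv _).bijective)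

end InitialThetaData

end Literature.IUT.HodgeTheaters

end
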